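import Summits.QuantumFields.YangMills.Theorems.UnitScaleTiltProp7CurrentSlavingLocal
import Summits.QuantumFields.YangMills.Theorems.UnitScaleTiltProp7CurrentSlavingGauge
import HarnessLib

/-!
# Route `UnitScaleTilt`, crux K1 child «MinimiserStabilityRegPr» (stmt-QuantumFields-19200), registered stub `stub_prop7From14` (V3, skeleton v7
# cc37a1787726) — lane B: **THE GAUGE-INVARIANT END PRODUCT OF «THE CURRENT IS SLAVED TO THE CURVATURE UNDER THE E–L PORT»** — for EVERY `SU(2)`
# configuration `U` of the d = 3 carrier with plaquette variables within `f` of `1` (the first member of [Balaban1985Variational] (2)∕(6), global) and a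
# LOCAL Euler–Lagrange port in the canonical slice-wise axial presentation near the bond `e` (defect `p` on `2R + 2` blocks along the axis of `e`, global
# a-priori size `A_g` of the candidate multiplier current): `c²‖(D^{1*}_U∂U)(e)‖ ≤ 12c²f(c⁻¹ + 2L^k·f) + 4p + 2^{−(R+1)}A_g`, `c = L^k`, `k = K − n` — with
# `f = ε₀L^{−2k}` this is `‖(D^{1*}_U∂U)(e)‖ ≤ 12ε₀(1 + 2ε₀)L^{−3k} + (4p + 2^{−(R+1)}A_g)L^{−2k}`, print's scaling of the SECOND member of (2), obtained
# from the first member and the port alone: no gauge condition on `U`, no Green's function, uniform in `k`, `m`, `n`, `K` and the volume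

Cell `ym3-torus` ∕ fleet seat `ym-ust-19200-p3` (WIDTH-LEVER lane B of V3 «regularity of the minimiser straight from the Euler–Lagrange system»; HUMAN RULING
D-0037, YM ladder rung R3).  `--supports stmt-QuantumFields-19200 --as helper`.  Assembly BY NAME of `UnitScaleTiltProp7CurrentSlavingLocal`
(`abs_current_le_of_multiplier_T3_local`, p547887) and `UnitScaleTiltProp7CurrentSlavingGauge` (`norm_sliceAxial_transverse_sub_one_le`, p548379).

WHAT IS PROVED (sorry-free, no definition, standard axioms): `axialT_mem_of` (comb transports stay in any subgroup), `gaugeActT_mem_of`,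
**`norm_current_le_of_port_sliceAxial_T3`** (the title statement; the port is asked for every real component `ℓ` of norm `≤ 1`, each with its own
candidate multiplier `ω_ℓ`, in the presentation `W = U^g`, `g(x) = U(Γ_{y(x),x})` the slice-wise comb based on the corner line of `B^k(x₀)` in the direction
of `e`; Hahn–Banach picks the norming component) and the component form `abs_current_le_of_port_sliceAxial_T3` (one `ℓ`, one `ω`).
HONEST SCOPE.  The port defect `p` and the a-priori size `A_g` are the consumer's (owner ruling g22-№5 §E: the E–L junction is the ★p2 lineage's); for
print's critical configurations `p` measures the distance of the true constraint force from the flat multiplier currents of the presentation.  Nothing here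
improves the plaquette member; nothing of Bałaban's nonlinear analysis is asserted; not a claim about the mass gap.

References: T. Bałaban, CMP **102** (1985) 277–309 [Balaban1985Variational] ((2) p.278, (6) p.278, (127) p.297, (133) p.298, (158) p.302); CMP **98** (1985)
17–51 [Balaban1985Averaging] (p.24–25); CMP **99** (1985) 75–102 [Balaban1985RegularSpaces] ((1.1)–(1.2) p.76, (1.11) p.77).
-/

set_option autoImplicit false

noncomputable section

open scoped BigOperators

namespace Summit.QuantumFields.YangMills.Theorems.Prop7CurrentSlaving

open Literature.MathematicalPhysics.QuantumFieldTheory.Balaban1983to89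
open Finset LatticeFieldCalculus B1RG242Torus
open B7Prop1Explicit (U1 mem_U1)
open B7Prop2Explicit (unitaryUnits hol_mem_of)
open B10Eq27TorusAxialLog (axialT holT gaugeActT gaugeActT_apply hol_pull_zero pull_apply unitsField toUField unitsField_mem_unitaryUnits
  U1_of_unitaryUnits)
open B10Eq68TorusRegularity (plaqFT covDivT norm_plaqFT_gaugeActT_sub_one norm_covDivT_gaugeActT)

variable {P : Params} {k : ℕ}

/-! ## §1 Gauge transformations by comb transports stay in any subgroup -/

section Subgroup

variable {G : Type*} [Group G]

/-- The comb transport `V(Γ_{y,x})` of an `S`-valued configuration lies in `S`. [cite: Balaban1985Averaging, p.24] -/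
theorem axialT_mem_of {j : ℕ} {S : Subgroup G} (V : GaugeField P j G) (hV : ∀ b, V b ∈ S) (y x : Site P j) : axialT V y x ∈ S := by
  unfold axialT
  rw [← hol_pull_zero]
  exact hol_mem_of (fun z κ => by rw [pull_apply]; exact hV _) 0 _

/-- A gauge transformation with values in `S` keeps an `S`-valued configuration `S`-valued. [cite: Balaban1985Averaging, (8) p.19] -/
theorem gaugeActT_mem_of {j : ℕ} {S : Subgroup G} (u : GaugeTransf P j G) (hu : ∀ x, u x ∈ S) (V : GaugeField P j G) (hV : ∀ b, V b ∈ S)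
    (b : PBond P j) : gaugeActT u V b ∈ S := by
  rw [gaugeActT_apply]
  exact S.mul_mem (S.mul_mem (hu _) (hV _)) (S.inv_mem (hu _))

end Subgroup

/-! ## §2 The gauge-invariant end product at the d = 3 carrier -/

section Carrier

open scoped Matrix.Norms.L2Operator
open T3ContinuumYM3Torus (T3Family)
open Summit.QuantumFields.YangMills.Theorems.Prop7FlatCoercivityR (succ_le_T3)
open B6SectAOperatorsV1 B6SectCTwoScaleV1 B6GOneLevelV1Bridge

/-- **THE SECOND MEMBER OF (2) FROM THE FIRST MEMBER AND A LOCAL E–L PORT, GAUGE-INVARIANTLY.**  Let `U` be ANY `SU(2)` configuration on the fine torus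
of run `K` (`k = K − n`, `c = L^k`) with `‖U(∂p) − 1‖ ≤ f` at every plaquette; let `e` be a fine bond with coarse bond `⟨x₀ + (R+2)e_μ, μ⟩`, and let
`W = U^g` be the slice-wise axial presentation along the axis of `e` (`g(x) = U(Γ_{y(x),x})`, comb based on the corner line of `B^k(x₀)`).  Suppose that for
every real component `ℓ` of norm `≤ 1` some coarse `ω` has port defect `|c²ℓ((D^{1*}_W∂W)(b)) − (Q*ω)(b)| ≤ p` at `b = e` and on the tubes of the `2R + 2`
coarse bonds `⟨x₀ + s·e_μ, μ⟩`, and `|(Q*ω)| ≤ A_g` everywhere.  Then `c²‖(D^{1*}_U∂U)(e)‖ ≤ 12c²f(c⁻¹ + 2L^k·f) + 4p + 2^{−(R+1)}A_g`.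
[cite: Balaban1985Variational, (2) p.278, (127) p.297, (133) p.298, (158) p.302; Balaban1985Averaging, p.24-25] -/
theorem norm_current_le_of_port_sliceAxial_T3 (F : T3Family) (n K : ℕ)
    (U : GaugeField (F.P K) 0 (Matrix.specialUnitaryGroup (Fin 2) ℂ)) {f : ℝ}
    (hfU : ∀ (s : Site (F.P K) 0) (κ μ : Fin 3), ‖plaqFT (unitsField (toUField U)) κ μ s - 1‖ ≤ f)
    (e : PBond (F.P K) 0) (x₀ : Site (F.P K) (K - n)) (R : ℕ) (he : Site.proj (K - n) (K - n) e.src = runSite x₀ e.dir (R + 2)) {p Ag : ℝ}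
    (hport : ∀ ℓ : Matrix (Fin 2) (Fin 2) ℂ →L[ℝ] ℝ, ‖ℓ‖ ≤ 1 →
      ∃ ω : BondIdxSpace (twoScale (K - n) (succ_le_T3 F n K) (∅ : Finset (Site (F.P K) (K - n + 1)))),
        |((F.L : ℝ) ^ (K - n)) ^ 2 * ℓ (covDivT 1
            (gaugeActT (fun x : Site (F.P K) 0 => axialT (unitsField (toUField U))
              (Function.update (Site.fibreSite 0 (K - n) x₀ fun _ => ⟨0, pow_pos (F.P K).L_pos (K - n)⟩) e.dir (x e.dir)) x)
              (unitsField (toUField U))) e.dir e.src)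
          - QsE (twoScale (K - n) (succ_le_T3 F n K) (∅ : Finset (Site (F.P K) (K - n + 1)))) ω e| ≤ p ∧
        (∀ (s : ℕ), 1 ≤ s → s ≤ 2 * R + 2 → ∀ (r : Fin 3 → Fin (F.L ^ (K - n))) (t : ℕ), t < F.L ^ (K - n) →
          |((F.L : ℝ) ^ (K - n)) ^ 2 * ℓ (covDivT 1
              (gaugeActT (fun x : Site (F.P K) 0 => axialT (unitsField (toUField U))
                (Function.update (Site.fibreSite 0 (K - n) x₀ fun _ => ⟨0, pow_pos (F.P K).L_pos (K - n)⟩) e.dir (x e.dir)) x)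
                (unitsField (toUField U))) e.dir (runSite (Site.fibreSite 0 (K - n) (runSite x₀ e.dir s) r) e.dir t))
            - QsE (twoScale (K - n) (succ_le_T3 F n K) (∅ : Finset (Site (F.P K) (K - n + 1)))) ω
                ⟨runSite (Site.fibreSite 0 (K - n) (runSite x₀ e.dir s) r) e.dir t, e.dir⟩| ≤ p) ∧
        (∀ b : PBond (F.P K) 0, |QsE (twoScale (K - n) (succ_le_T3 F n K) (∅ : Finset (Site (F.P K) (K - n + 1)))) ω b| ≤ Ag)) :
    ((F.L : ℝ) ^ (K - n)) ^ 2 * ‖covDivT 1 (unitsField (toUField U)) e.dir e.src‖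
      ≤ 12 * ((F.L : ℝ) ^ (K - n)) ^ 2 * f * (((F.L : ℝ) ^ (K - n))⁻¹ + 2 * (F.L : ℝ) ^ (K - n) * f) + 4 * p + (1 / 2) ^ (R + 1) * Ag := by
  letI : CStarAlgebra (Matrix (Fin 2) (Fin 2) ℂ) := B10Eq29TubeLine.cstarAlgebraMatrix 2
  set V : GaugeField (F.P K) 0 (Matrix (Fin 2) (Fin 2) ℂ)ˣ := unitsField (toUField U) with hVdef
  set g : GaugeTransf (F.P K) 0 (Matrix (Fin 2) (Fin 2) ℂ)ˣ := fun x : Site (F.P K) 0 => axialT V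
      (Function.update (Site.fibreSite 0 (K - n) x₀ fun _ => ⟨0, pow_pos (F.P K).L_pos (K - n)⟩) e.dir (x e.dir)) x with hgdef
  set W : GaugeField (F.P K) 0 (Matrix (Fin 2) (Fin 2) ℂ)ˣ := gaugeActT g V with hWdef
  have hk : K - n ≤ (F.P K).m + (F.P K).K := Nat.le_of_succ_le (succ_le_T3 F n K)
  have hmK : 1 ≤ (F.P K).m + (F.P K).K := by have := F.hm; show 1 ≤ F.m + K; omega
  have hVu : ∀ b, V b ∈ unitaryUnits (Matrix (Fin 2) (Fin 2) ℂ) := fun b => unitsField_mem_unitaryUnits _ b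
  have hV1 : ∀ b, V b ∈ U1 (Matrix (Fin 2) (Fin 2) ℂ) := U1_of_unitaryUnits hVu
  have hgu : ∀ x, g x ∈ unitaryUnits (Matrix (Fin 2) (Fin 2) ℂ) := fun x => axialT_mem_of V hVu _ x
  have hg1 : ∀ x, g x ∈ U1 (Matrix (Fin 2) (Fin 2) ℂ) := fun x => axialT_mem_of V hV1 _ x
  have hWu : ∀ b, W b ∈ unitaryUnits (Matrix (Fin 2) (Fin 2) ℂ) := fun b => gaugeActT_mem_of g hgu V hVu b
  have hf : 0 ≤ f := (norm_nonneg _).trans (hfU e.src 0 0)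
  -- the presentation: plaquettes unchanged, transverse bonds near the identity uniformly along the axis
  have hfW : ∀ (s : Site (F.P K) 0) (κ μ : Fin 3), ‖plaqFT W κ μ s - 1‖ ≤ f := by
    intro s κ μ
    rw [hWdef, norm_plaqFT_gaugeActT_sub_one hg1]
    exact hfU s κ μ
  have hd : (((F.P K).d : ℝ)) = 3 := by norm_num [show (F.P K).d = 3 from rfl]
  have haW : ∀ (s : ℕ), 1 ≤ s → s ≤ 2 * R + 2 → ∀ (r : Fin 3 → Fin (F.L ^ (K - n))) (t : ℕ) (ν : Fin 3), ν ≠ e.dir →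
      t < F.L ^ (K - n) →
      ‖(W ⟨(runSite (Site.fibreSite 0 (K - n) (runSite x₀ e.dir s) r) e.dir t).unshift ν, ν⟩ : Matrix (Fin 2) (Fin 2) ℂ) - 1‖
        ≤ 2 * (F.L : ℝ) ^ (K - n) * f := by
    intro s _ _ r t ν hν _
    have h := norm_sliceAxial_transverse_sub_one_le hk hmK V hV1 hf (fun x κ κ' _ => hfU x κ κ') x₀ e.dir s t r hν
    have hPL : ((F.P K).L : ℝ) = (F.L : ℝ) := rfl
    rw [hd, hPL] at h
    refine h.trans (le_of_eq ?_)
    ring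
  -- the norming component of the current of `W` at `e`
  obtain ⟨ℓ, hℓ1, hℓx⟩ := exists_dual_vector' ℝ (covDivT 1 W e.dir e.src)
  obtain ⟨ω, hωe, hωnear, hAg⟩ := hport ℓ hℓ1.le
  have h := abs_current_le_of_multiplier_T3_local F n K W hWu hfW ℓ hℓ1.le e x₀ R he haW ω hωe hωnear hAg
  have hℓx' : ℓ (covDivT 1 W e.dir e.src) = ‖covDivT 1 W e.dir e.src‖ := by simpa using hℓx
  rw [hℓx'] at h
  have hnorm : ‖covDivT 1 W e.dir e.src‖ = ‖covDivT 1 V e.dir e.src‖ := by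
    rw [hWdef]; exact norm_covDivT_gaugeActT 1 hg1 V e.dir e.src
  rw [← hnorm]
  exact (le_abs_self _).trans h

/-- **COMPONENT FORM** (one real component `ℓ`, one candidate multiplier — e.g. when the port is available only along `𝔰𝔲(2)`): in the setting of
`norm_current_le_of_port_sliceAxial_T3`, for a single `ℓ` with `‖ℓ‖ ≤ 1` and port defect `p` (at `e` and on the `2R + 2` tubes) in the slice-wise axial
presentation `W = U^g`: `|c²ℓ((D^{1*}_W∂W)(e))| ≤ 12c²f(c⁻¹ + 2L^k·f) + 4p + 2^{−(R+1)}A_g`. [cite: Balaban1985Variational, (2) p.278, (158) p.302] -/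
theorem abs_current_le_of_port_sliceAxial_T3 (F : T3Family) (n K : ℕ)
    (U : GaugeField (F.P K) 0 (Matrix.specialUnitaryGroup (Fin 2) ℂ)) {f : ℝ}
    (hfU : ∀ (s : Site (F.P K) 0) (κ μ : Fin 3), ‖plaqFT (unitsField (toUField U)) κ μ s - 1‖ ≤ f)
    (e : PBond (F.P K) 0) (x₀ : Site (F.P K) (K - n)) (R : ℕ) (he : Site.proj (K - n) (K - n) e.src = runSite x₀ e.dir (R + 2))
    (ℓ : Matrix (Fin 2) (Fin 2) ℂ →L[ℝ] ℝ) (hℓ : ‖ℓ‖ ≤ 1)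
    (ω : BondIdxSpace (twoScale (K - n) (succ_le_T3 F n K) (∅ : Finset (Site (F.P K) (K - n + 1))))) {p Ag : ℝ}
    (hωe : |((F.L : ℝ) ^ (K - n)) ^ 2 * ℓ (covDivT 1
        (gaugeActT (fun x : Site (F.P K) 0 => axialT (unitsField (toUField U))
          (Function.update (Site.fibreSite 0 (K - n) x₀ fun _ => ⟨0, pow_pos (F.P K).L_pos (K - n)⟩) e.dir (x e.dir)) x)
          (unitsField (toUField U))) e.dir e.src)
      - QsE (twoScale (K - n) (succ_le_T3 F n K) (∅ : Finset (Site (F.P K) (K - n + 1)))) ω e| ≤ p)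
    (hωnear : ∀ (s : ℕ), 1 ≤ s → s ≤ 2 * R + 2 → ∀ (r : Fin 3 → Fin (F.L ^ (K - n))) (t : ℕ), t < F.L ^ (K - n) →
      |((F.L : ℝ) ^ (K - n)) ^ 2 * ℓ (covDivT 1
          (gaugeActT (fun x : Site (F.P K) 0 => axialT (unitsField (toUField U))
            (Function.update (Site.fibreSite 0 (K - n) x₀ fun _ => ⟨0, pow_pos (F.P K).L_pos (K - n)⟩) e.dir (x e.dir)) x)
            (unitsField (toUField U))) e.dir (runSite (Site.fibreSite 0 (K - n) (runSite x₀ e.dir s) r) e.dir t))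
        - QsE (twoScale (K - n) (succ_le_T3 F n K) (∅ : Finset (Site (F.P K) (K - n + 1)))) ω
            ⟨runSite (Site.fibreSite 0 (K - n) (runSite x₀ e.dir s) r) e.dir t, e.dir⟩| ≤ p)
    (hAg : ∀ b : PBond (F.P K) 0, |QsE (twoScale (K - n) (succ_le_T3 F n K) (∅ : Finset (Site (F.P K) (K - n + 1)))) ω b| ≤ Ag) :
    |((F.L : ℝ) ^ (K - n)) ^ 2 * ℓ (covDivT 1
        (gaugeActT (fun x : Site (F.P K) 0 => axialT (unitsField (toUField U))
          (Function.update (Site.fibreSite 0 (K - n) x₀ fun _ => ⟨0, pow_pos (F.P K).L_pos (K - n)⟩) e.dir (x e.dir)) x)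
          (unitsField (toUField U))) e.dir e.src)|
      ≤ 12 * ((F.L : ℝ) ^ (K - n)) ^ 2 * f * (((F.L : ℝ) ^ (K - n))⁻¹ + 2 * (F.L : ℝ) ^ (K - n) * f) + 4 * p + (1 / 2) ^ (R + 1) * Ag := by
  letI : CStarAlgebra (Matrix (Fin 2) (Fin 2) ℂ) := B10Eq29TubeLine.cstarAlgebraMatrix 2
  set V : GaugeField (F.P K) 0 (Matrix (Fin 2) (Fin 2) ℂ)ˣ := unitsField (toUField U) with hVdef
  set g : GaugeTransf (F.P K) 0 (Matrix (Fin 2) (Fin 2) ℂ)ˣ := fun x : Site (F.P K) 0 => axialT V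
      (Function.update (Site.fibreSite 0 (K - n) x₀ fun _ => ⟨0, pow_pos (F.P K).L_pos (K - n)⟩) e.dir (x e.dir)) x with hgdef
  set W : GaugeField (F.P K) 0 (Matrix (Fin 2) (Fin 2) ℂ)ˣ := gaugeActT g V with hWdef
  have hk : K - n ≤ (F.P K).m + (F.P K).K := Nat.le_of_succ_le (succ_le_T3 F n K)
  have hmK : 1 ≤ (F.P K).m + (F.P K).K := by have := F.hm; show 1 ≤ F.m + K; omega
  have hVu : ∀ b, V b ∈ unitaryUnits (Matrix (Fin 2) (Fin 2) ℂ) := fun b => unitsField_mem_unitaryUnits _ b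
  have hV1 : ∀ b, V b ∈ U1 (Matrix (Fin 2) (Fin 2) ℂ) := U1_of_unitaryUnits hVu
  have hgu : ∀ x, g x ∈ unitaryUnits (Matrix (Fin 2) (Fin 2) ℂ) := fun x => axialT_mem_of V hVu _ x
  have hg1 : ∀ x, g x ∈ U1 (Matrix (Fin 2) (Fin 2) ℂ) := fun x => axialT_mem_of V hV1 _ x
  have hWu : ∀ b, W b ∈ unitaryUnits (Matrix (Fin 2) (Fin 2) ℂ) := fun b => gaugeActT_mem_of g hgu V hVu b
  have hf : 0 ≤ f := (norm_nonneg _).trans (hfU e.src 0 0)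
  have hfW : ∀ (s : Site (F.P K) 0) (κ μ : Fin 3), ‖plaqFT W κ μ s - 1‖ ≤ f := by
    intro s κ μ
    rw [hWdef, norm_plaqFT_gaugeActT_sub_one hg1]
    exact hfU s κ μ
  have hd : (((F.P K).d : ℝ)) = 3 := by norm_num [show (F.P K).d = 3 from rfl]
  have haW : ∀ (s : ℕ), 1 ≤ s → s ≤ 2 * R + 2 → ∀ (r : Fin 3 → Fin (F.L ^ (K - n))) (t : ℕ) (ν : Fin 3), ν ≠ e.dir →
      t < F.L ^ (K - n) →
      ‖(W ⟨(runSite (Site.fibreSite 0 (K - n) (runSite x₀ e.dir s) r) e.dir t).unshift ν, ν⟩ : Matrix (Fin 2) (Fin 2) ℂ) - 1‖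
        ≤ 2 * (F.L : ℝ) ^ (K - n) * f := by
    intro s _ _ r t ν hν _
    have h := norm_sliceAxial_transverse_sub_one_le hk hmK V hV1 hf (fun x κ κ' _ => hfU x κ κ') x₀ e.dir s t r hν
    have hPL : ((F.P K).L : ℝ) = (F.L : ℝ) := rfl
    rw [hd, hPL] at h
    refine h.trans (le_of_eq ?_)
    ring
  exact abs_current_le_of_multiplier_T3_local F n K W hWu hfW ℓ hℓ e x₀ R he haW ω hωe hωnear hAg

end Carrier

end Summit.QuantumFields.YangMills.Theorems.Prop7CurrentSlaving

end
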